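import Summits.ResolutionOfSingularities.ResolutionOfSingularities.Theorems.FrobeniusLadderFInjectiveMacaulayficationBlowupFiModel
import Summits.ResolutionOfSingularities.ResolutionOfSingularities.Theorems.FrobeniusLadderFInjectiveMacaulayficationFedderClosure
import Summits.ResolutionOfSingularities.ResolutionOfSingularities.Theorems.FrobeniusLadderFInjectiveMacaulayficationE8Char5FiModel
import Mathlib.RingTheory.RegularLocalRing.Polynomial
import Mathlib.RingTheory.Localization.LocalizationLocalization
import HarnessLib

/-!
# The pointwise certificate on the charts of the blow-up of an isolated hypersurface singularity

Support file for crux stmt-ResolutionOfSingularities-15316 (`FrobeniusLadder.FRationalModification`, line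
`socle-discrepancy-certificate`, stub `stub_maxMultiplicityCertificate`): the chart-level form of the
certificate, everything except the identification of the exceptional divisor.

`R` is a Noetherian local domain of characteristic `p` whose punctured spectrum is regular (`hreg`),
`𝔪 = (x₀, …, x_{r-1})`, `A = (R[𝔪t])_{(x_i t)} = R[𝔪/x_i]` the chart of `Bl_𝔪(Spec R)` at a non-zero
generator `x_i`, `u = x_i/1 ∈ A` the equation of the exceptional divisor `E` (`AffineBlowup.lean`). Then:

* `isRegularRing_away` — `R[1/a]` is a regular ring for `a ∈ 𝔪` (its local rings are the `R_P`, `P ≠ 𝔪`);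
* `isRegularLocalRing_atPrime_of_notMem` — off `E` the chart is regular: `A_q ≅ R_{q ∩ R}` for `u ∉ q`
  (`BlowupFiModel.nonempty_ringEquiv_offExceptional`);
* `isRegularRing_away_algebraMap` — for `u ∈ q`, `A_q[1/u]` is regular (a localization of `A` at primes
  not containing `u`);
* `certificate_atPrime` — **the certificate at every prime `q` of `A`**: `A_q` is regular, or (`u ∈ q`)
  `A_q` is a domain, `u/1 ∈ q A_q` is non-zero, `A_q[1/u]` is regular, and `A_q/(u) ≅ (A/(u))_{q/(u)}`
  (`QuotLocalizationIso`) satisfies the Cohen–Macaulay + Frobenius-closed clause — GIVEN the clause at the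
  local rings of the exceptional chart `A/(u)` (hypothesis `hexc`);
* `exceptional_clause_of_presentation` — that hypothesis from a presentation `A/(u) ≅ k[T_j : j ≠ i]/(g)`
  by a polynomial `g` passing Fedder's test at every prime (`Fedder.fedder_hypersurface_clause` in the
  regular local rings `k[T]_Q`), as the tangent-cone files of the stub supply it.

References: The Stacks Project, Tags 0804, 02OS; R. Fedder, Trans. AMS 278 (1983), Prop. 1.7, Thm. 1.12.
[folklore]
-/

-- single-problem summit: the doubled namespace component is forced
set_option linter.dupNamespace false

noncomputable section

namespace Summit.ResolutionOfSingularities.ResolutionOfSingularities.Theorems.FRationalModification.MaxMultiplicityCertificateChartClause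

open IsLocalRing Literature.AlgebraicGeometry.Resolution Literature.RingTheory.TightClosure
open Summit.ResolutionOfSingularities.ResolutionOfSingularities.Theorems

/-- The Cohen–Macaulay + Frobenius-closed clause of the crux at a ring `X` (inline form). -/
local notation3 "CLAUSE[" p ", " X "]" => ∀ d : ℕ, ringKrullDim X = (d : WithBot ℕ∞) → ∀ s : Fin d → X,
  (Ideal.radical (R := X) (Ideal.span (Set.range s))).IsMaximal →
    RingTheory.Sequence.IsWeaklyRegular X (List.ofFn s) ∧
    ∀ y : X, (∃ e : ℕ, y ^ p ^ e ∈ Ideal.span ((fun z : X => z ^ p ^ e) '' (Ideal.span (Set.range s) : Set X))) →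
      y ∈ Ideal.span (Set.range s)

/-! ## Off the closed point `R` is regular -/

section Base

variable {R : Type} [CommRing R] [IsNoetherianRing R] [IsLocalRing R]
  (hreg : ∀ (q : Ideal R) [q.IsPrime], q ≠ maximalIdeal R → IsRegularLocalRing (Localization.AtPrime q))

include hreg in
/-- **`R[1/a]` is regular for `a ∈ 𝔪`** when the punctured spectrum of the local ring `R` is regular:
its local rings are the `R_P` at the primes `P ∌ a`, `P ≠ 𝔪`. [folklore] -/
theorem isRegularRing_away {a : R} (ha : a ∈ maximalIdeal R) : IsRegularRing (Localization.Away a) := by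
  haveI : IsNoetherianRing (Localization.Away a) := inferInstance
  rw [isRegularRing_iff]
  intro P hP
  set P₀ : Ideal R := P.comap (algebraMap R (Localization.Away a)) with hP₀
  have haP₀ : a ∉ P₀ := fun h => hP.ne_top (P.eq_top_of_isUnit_mem (Ideal.mem_comap.mp h)
    (IsLocalization.Away.algebraMap_isUnit a))
  have hne : P₀ ≠ maximalIdeal R := fun h => haP₀ (h ▸ ha)
  haveI := hreg P₀ hne
  haveI : IsLocalization.AtPrime (Localization.AtPrime P) P₀ :=
    IsLocalization.isLocalization_isLocalization_atPrime_isLocalization (Submonoid.powers a)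
      (Localization.AtPrime P) P
  exact IsRegularLocalRing.of_ringEquiv (IsLocalization.algEquiv P₀.primeCompl
    (Localization.AtPrime P₀) (Localization.AtPrime P)).toRingEquiv

end Base

/-! ## The charts -/

section Chart

variable {R : Type} [CommRing R] [IsLocalRing R] {r : ℕ} (x : Fin r → R)
  (hx : Ideal.span (Set.range x) = maximalIdeal R)
  (hreg : ∀ (q : Ideal R) [q.IsPrime], q ≠ maximalIdeal R → IsRegularLocalRing (Localization.AtPrime q))
  (i : Fin r)

local notation3 "I" => Ideal.span (Set.range x)
local notation3 "A" => HomogeneousLocalization.Away (reesGrading I)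
  (reesT (x i) (Ideal.mem_span_range_self (f := x) (x := i)))
local notation3 "φ" => reesChartBase (x i) (Ideal.mem_span_range_self (f := x) (x := i))

include hx hreg in
/-- **Off the exceptional divisor the chart is regular**: for a prime `q ∌ u = x_i/1` of the chart ring
`A`, `A_q ≅ R_{q ∩ R}` (`BlowupFiModel.nonempty_ringEquiv_offExceptional`) with `q ∩ R ∌ x_i`, hence
`q ∩ R ≠ 𝔪` and `R_{q ∩ R}` regular. [cite: StacksProject, Tag 02OS] [folklore] -/
theorem isRegularLocalRing_atPrime_of_notMem (q : Ideal A) [q.IsPrime] (huq : φ (x i) ∉ q) :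
    IsRegularLocalRing (Localization.AtPrime q) := by
  obtain ⟨e⟩ := FInjectiveMacaulayfication.BlowupFiModel.nonempty_ringEquiv_offExceptional (x i)
    (Ideal.mem_span_range_self (f := x) (x := i)) q huq
  have hxq : x i ∉ q.comap φ := fun h => huq (Ideal.mem_comap.mp h)
  have hne : q.comap φ ≠ maximalIdeal R := fun h => hxq (h ▸ hx ▸ Ideal.mem_span_range_self)
  haveI := hreg (q.comap φ) hne
  exact IsRegularLocalRing.of_ringEquiv e.symm

end Chart

/-! ## The certificate at the primes of a ring with a marked element -/

section Marked

variable {A : Type} [CommRing A] [IsNoetherianRing A] (u : A)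
  (hoff : ∀ (Q : Ideal A) [Q.IsPrime], u ∉ Q → IsRegularLocalRing (Localization.AtPrime Q))

include hoff in
/-- **`A_q[1/u]` is regular** when `A` is regular at the primes not containing `u`: `A_q[1/u]` is a
localization of `A` whose local rings are local rings `A_Q` at primes `Q ∌ u`. [folklore] -/
theorem isRegularRing_away_algebraMap (q : Ideal A) [q.IsPrime] :
    IsRegularRing (Localization.Away (algebraMap A (Localization.AtPrime q) u)) := by
  set T : Type := Localization.Away (algebraMap A (Localization.AtPrime q) u)
  haveI : IsNoetherianRing T := inferInstance
  -- `T` is a localization of `A`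
  haveI hT : IsLocalization (IsLocalization.localizationLocalizationSubmodule q.primeCompl
      (Submonoid.powers (algebraMap A (Localization.AtPrime q) u))) T :=
    IsLocalization.localization_localization_isLocalization q.primeCompl
      (Submonoid.powers (algebraMap A (Localization.AtPrime q) u)) T
  rw [isRegularRing_iff]
  intro P hP
  set Q : Ideal A := P.comap (algebraMap A T) with hQ
  have huQ : u ∉ Q := fun h => hP.ne_top (P.eq_top_of_isUnit_mem (Ideal.mem_comap.mp h) (by
    rw [IsScalarTower.algebraMap_apply A (Localization.AtPrime q) T]
    exact IsLocalization.Away.algebraMap_isUnit _))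
  haveI := hoff Q huQ
  haveI : IsLocalization.AtPrime (Localization.AtPrime P) Q :=
    IsLocalization.isLocalization_isLocalization_atPrime_isLocalization
      (IsLocalization.localizationLocalizationSubmodule q.primeCompl
        (Submonoid.powers (algebraMap A (Localization.AtPrime q) u))) (Localization.AtPrime P) P
  exact IsRegularLocalRing.of_ringEquiv (IsLocalization.algEquiv Q.primeCompl
    (Localization.AtPrime Q) (Localization.AtPrime P)).toRingEquiv

include hoff in
/-- **The certificate at every prime of a Noetherian domain `A` with a marked element `u ≠ 0`** such that
`A` is regular off `V(u)` and the local rings of `A/(u)` are Cohen–Macaulay with Frobenius-closed parameter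
ideals: either `A_q` is regular (`u ∉ q`), or `A_q` is a domain, `t = u/1 ∈ q A_q` is non-zero, `A_q[1/t]`
is regular, and `A_q/(t) ≅ (A/(u))_{q/(u)}` (`QuotLocalizationIso`) satisfies the clause. [folklore] -/
theorem certificate_atPrime_of (p : ℕ) [IsDomain A] (hu0 : u ≠ 0)
    (hexc : ∀ (Q : Ideal (A ⧸ Ideal.span {u})) [Q.IsPrime], CLAUSE[p, Localization.AtPrime Q])
    (q : Ideal A) [q.IsPrime] :
    IsRegularLocalRing (Localization.AtPrime q) ∨
      (IsDomain (Localization.AtPrime q) ∧ ∃ t : Localization.AtPrime q,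
        t ∈ maximalIdeal (Localization.AtPrime q) ∧ t ≠ 0 ∧ IsRegularRing (Localization.Away t) ∧
        CLAUSE[p, Localization.AtPrime q ⧸ Ideal.span {t}]) := by
  by_cases huq : u ∈ q
  · right
    refine ⟨IsLocalization.isDomain_localization q.primeCompl_le_nonZeroDivisors,
      algebraMap A (Localization.AtPrime q) u, ?_, ?_, isRegularRing_away_algebraMap u hoff q, ?_⟩
    · exact (IsLocalization.AtPrime.to_map_mem_maximal_iff (Localization.AtPrime q) q _).mpr huq
    · intro h0
      have hinj := IsLocalization.injective (Localization.AtPrime q) q.primeCompl_le_nonZeroDivisors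
      rw [← map_zero (algebraMap A (Localization.AtPrime q))] at h0
      exact hu0 (hinj h0)
    · -- `A_q/(u) ≅ (A/(u))_{q/(u)}`
      have hker : RingHom.ker (Ideal.Quotient.mk (Ideal.span {u})) ≤ q := by
        rw [Ideal.mk_ker, Ideal.span_singleton_le_iff_mem]
        exact huq
      haveI hQ' : (q.map (Ideal.Quotient.mk (Ideal.span {u}))).IsPrime :=
        Ideal.map_isPrime_of_surjective Ideal.Quotient.mk_surjective hker
      have hcomap : (q.map (Ideal.Quotient.mk (Ideal.span {u}))).comap (Ideal.Quotient.mk (Ideal.span {u})) = q := by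
        rw [Ideal.comap_map_of_surjective _ Ideal.Quotient.mk_surjective, ← RingHom.ker_eq_comap_bot,
          sup_eq_left]
        exact hker
      obtain ⟨e⟩ := FInjectiveMacaulayfication.QuotLocalizationIso.stub_quotLocalizationIso A u q
        (q.map (Ideal.Quotient.mk (Ideal.span {u}))) hcomap
      exact FInjectiveMacaulayfication.DegreeZeroDescent.inlineClause_of_ringEquiv p e.symm (hexc _)
  · left
    exact hoff q huq

end Marked

/-! ## The certificate on the blow-up charts -/

section Chart2

variable (p : ℕ) {R : Type} [CommRing R] [IsNoetherianRing R] [IsLocalRing R] [IsDomain R]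
  {r : ℕ} (x : Fin r → R) (hx : Ideal.span (Set.range x) = maximalIdeal R)
  (hreg : ∀ (q : Ideal R) [q.IsPrime], q ≠ maximalIdeal R → IsRegularLocalRing (Localization.AtPrime q))
  (i : Fin r) (hxi : x i ≠ 0)

local notation3 "I" => Ideal.span (Set.range x)
local notation3 "A" => HomogeneousLocalization.Away (reesGrading I)
  (reesT (x i) (Ideal.mem_span_range_self (f := x) (x := i)))
local notation3 "φ" => reesChartBase (x i) (Ideal.mem_span_range_self (f := x) (x := i))

include hx hreg hxi in
/-- **The certificate on the chart** `A = (R[𝔪t])_{(x_i t)}` of the blow-up of the closed point of a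
Noetherian local domain `R` with regular punctured spectrum, at every prime `q`: either `A_q` is a regular
local ring, or `A_q` is a domain and `t = (x_i/1)/1` is a non-zero element of its maximal ideal with
`A_q[1/t]` regular and `A_q/(t)` Cohen–Macaulay with Frobenius-closed parameter ideals — GIVEN the clause
at the local rings of the exceptional chart `A/(x_i/1)` (hypothesis `hexc`). [folklore] -/
theorem certificate_atPrime
    (hexc : ∀ (Q : Ideal (A ⧸ Ideal.span {φ (x i)})) [Q.IsPrime], CLAUSE[p, Localization.AtPrime Q])
    (q : Ideal A) [q.IsPrime] :
    IsRegularLocalRing (Localization.AtPrime q) ∨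
      (IsDomain (Localization.AtPrime q) ∧ ∃ t : Localization.AtPrime q,
        t ∈ maximalIdeal (Localization.AtPrime q) ∧ t ≠ 0 ∧ IsRegularRing (Localization.Away t) ∧
        CLAUSE[p, Localization.AtPrime q ⧸ Ideal.span {t}]) := by
  haveI : IsDomain A := FInjectiveMacaulayfication.ReesChartRing.isDomain_away _ _ hxi
  haveI : IsNoetherianRing A :=
    FInjectiveMacaulayfication.ReesChartRing.isNoetherianRing_away (x i) (Ideal.mem_span_range_self (f := x) (x := i))
  have hu0 : φ (x i) ≠ 0 := nonZeroDivisors.ne_zero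
    (reesChartBase_mem_nonZeroDivisors (x i) (Ideal.mem_span_range_self (f := x) (x := i)))
  exact certificate_atPrime_of (φ (x i)) (fun Q _ hQ => isRegularLocalRing_atPrime_of_notMem x hx hreg i Q hQ)
    p hu0 hexc q

end Chart2


/-! ## The clause on the exceptional chart from a Fedder presentation -/

/-- **The clause at every local ring of a ring presented as `k[T_j : j ≠ i]/(g)` with `g` passing Fedder's
test everywhere**: if `C ≅ B/(g)`, `B = k[T_j : j ≠ i]` over a field `k` of characteristic `p`, and for
every prime `Q ∋ g` of `B` the image of `g^(p-1)` in `B_Q` avoids `(Q B_Q)^[p]`, then every local ring `C_Q`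
is Cohen–Macaulay with Frobenius-closed parameter ideals: `C_Q ≅ (B/(g))_{Q'} ≅ B_{Q''}/(g)`
(`QuotLocalizationIso`, `E8Char5FiModel.nonempty_ringEquiv_localization_comap`) and Fedder's criterion in the
regular local ring `B_{Q''}` (`Fedder.fedder_hypersurface_clause`). [cite: Fedder1983, Prop. 1.7 and Thm. 1.12] [folklore] -/
theorem exceptional_clause_of_presentation (p : ℕ) [Fact p.Prime] {k : Type} [Field k] [CharP k p]
    {r : ℕ} (i : Fin r) (g : MvPolynomial {j : Fin r // j ≠ i} k)
    (hg : ∀ (Q : Ideal (MvPolynomial {j : Fin r // j ≠ i} k)) [Q.IsPrime], g ∈ Q →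
      algebraMap (MvPolynomial {j : Fin r // j ≠ i} k) (Localization.AtPrime Q) g ^ (p - 1) ∉
        frobeniusPower p (maximalIdeal (Localization.AtPrime Q)))
    {C : Type} [CommRing C] (ε : (MvPolynomial {j : Fin r // j ≠ i} k ⧸ Ideal.span {g}) ≃+* C)
    (Q : Ideal C) [Q.IsPrime] : CLAUSE[p, Localization.AtPrime Q] := by
  -- `C_Q ≅ (B/(g))_{Q₁}`, `Q₁ = ε⁻¹ Q`
  obtain ⟨e₁⟩ := FInjectiveMacaulayfication.E8Char5FiModel.nonempty_ringEquiv_localization_comap ε Q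
  set Q₁ : Ideal (MvPolynomial {j : Fin r // j ≠ i} k ⧸ Ideal.span {g}) := Q.comap ε.toRingHom with hQ₁
  -- `(B/(g))_{Q₁} ≅ B_{Q₂}/(g)`, `Q₂ = Q₁ ∩ B ∋ g`
  set Q₂ : Ideal (MvPolynomial {j : Fin r // j ≠ i} k) := Q₁.comap (Ideal.Quotient.mk (Ideal.span {g}))
    with hQ₂
  obtain ⟨e₂⟩ := FInjectiveMacaulayfication.QuotLocalizationIso.stub_quotLocalizationIso
    (MvPolynomial {j : Fin r // j ≠ i} k) g Q₂ Q₁ rfl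
  have hgQ₂ : g ∈ Q₂ := by
    rw [hQ₂, Ideal.mem_comap, Ideal.Quotient.eq_zero_iff_mem.mpr (Ideal.mem_span_singleton_self g)]
    exact zero_mem _
  -- Fedder in the regular local ring `B_{Q₂}`
  haveI : CharP (Localization.AtPrime Q₂) p :=
    FInjectiveMacaulayfication.FrobeniusClosedLocalizes.charP_localizationAtPrime p Q₂
  have hmem : algebraMap (MvPolynomial {j : Fin r // j ≠ i} k) (Localization.AtPrime Q₂) g ∈
      maximalIdeal (Localization.AtPrime Q₂) :=
    (IsLocalization.AtPrime.to_map_mem_maximal_iff (Localization.AtPrime Q₂) Q₂ g).mpr hgQ₂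
  obtain ⟨hF, hCM⟩ := FInjectiveMacaulayfication.Fedder.fedder_hypersurface_clause p
    (Localization.AtPrime Q₂) (algebraMap (MvPolynomial {j : Fin r // j ≠ i} k) (Localization.AtPrime Q₂) g)
    hmem (hg Q₂ hgQ₂)
  have hcl : CLAUSE[p, Localization.AtPrime Q₂ ⧸
      Ideal.span {algebraMap (MvPolynomial {j : Fin r // j ≠ i} k) (Localization.AtPrime Q₂) g}] := by
    intro d hd s hs
    exact ⟨hCM d hd s hs, fun y hy => hF (Ideal.span (Set.range s)) y hy⟩
  exact FInjectiveMacaulayfication.DegreeZeroDescent.inlineClause_of_ringEquiv p e₁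
    (FInjectiveMacaulayfication.DegreeZeroDescent.inlineClause_of_ringEquiv p e₂ hcl)

/-! ## Registered form -/

/-- **The certificate on the charts of the blow-up of the closed point** (registered helper-stub form,
fully explicit binders; = `certificate_atPrime`): `R` a Noetherian local domain with regular punctured
spectrum, `𝔪 = (x)`, `x_i ≠ 0`; if the local rings of the exceptional chart `A/(x_i/1)`,
`A = (R[𝔪t])_{(x_i t)}`, are Cohen–Macaulay with Frobenius-closed parameter ideals, then at every prime `q`
of `A` either `A_q` is regular or `A_q` is certified (domain; `t = x_i/1 ∈ q A_q` non-zero; `A_q[1/t]`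
regular; `A_q/(t)` Cohen–Macaulay with Frobenius-closed parameter ideals). [folklore] -/
theorem chartCertificate (p : ℕ) (R : Type) [CommRing R] [IsNoetherianRing R] [IsLocalRing R] [IsDomain R]
    (r : ℕ) (x : Fin r → R) (hx : Ideal.span (Set.range x) = IsLocalRing.maximalIdeal R)
    (hreg : ∀ (q : Ideal R) [q.IsPrime], q ≠ IsLocalRing.maximalIdeal R →
      IsRegularLocalRing (Localization.AtPrime q))
    (i : Fin r) (hxi : x i ≠ 0)
    (hexc : ∀ (Q : Ideal (HomogeneousLocalization.Away (Literature.AlgebraicGeometry.Resolution.reesGrading (Ideal.span (Set.range x))) (Literature.AlgebraicGeometry.Resolution.reesT (x i) (Ideal.subset_span (Set.mem_range_self i))) ⧸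
        Ideal.span {Literature.AlgebraicGeometry.Resolution.reesChartBase (x i) (Ideal.subset_span (Set.mem_range_self i)) (x i)})) [Q.IsPrime],
      ∀ d : ℕ, ringKrullDim (Localization.AtPrime Q) = (d : WithBot ℕ∞) → ∀ s : Fin d → Localization.AtPrime Q, (Ideal.span (Set.range s)).radical.IsMaximal → RingTheory.Sequence.IsWeaklyRegular (Localization.AtPrime Q) (List.ofFn s) ∧ ∀ y : Localization.AtPrime Q, (∃ e : ℕ, y ^ p ^ e ∈ Ideal.span ((fun z : Localization.AtPrime Q => z ^ p ^ e) '' (Ideal.span (Set.range s) : Set (Localization.AtPrime Q)))) → y ∈ Ideal.span (Set.range s))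
    (q : Ideal (HomogeneousLocalization.Away (Literature.AlgebraicGeometry.Resolution.reesGrading (Ideal.span (Set.range x))) (Literature.AlgebraicGeometry.Resolution.reesT (x i) (Ideal.subset_span (Set.mem_range_self i))))) [q.IsPrime] :
    IsRegularLocalRing (Localization.AtPrime q) ∨
      (IsDomain (Localization.AtPrime q) ∧ ∃ t : Localization.AtPrime q,
        t ∈ IsLocalRing.maximalIdeal (Localization.AtPrime q) ∧ t ≠ 0 ∧ IsRegularRing (Localization.Away t) ∧
        ∀ d : ℕ, ringKrullDim (Localization.AtPrime q ⧸ Ideal.span {t}) = (d : WithBot ℕ∞) → ∀ s : Fin d → Localization.AtPrime q ⧸ Ideal.span {t}, (Ideal.span (Set.range s)).radical.IsMaximal → RingTheory.Sequence.IsWeaklyRegular (Localization.AtPrime q ⧸ Ideal.span {t}) (List.ofFn s) ∧ ∀ y : Localization.AtPrime q ⧸ Ideal.span {t}, (∃ e : ℕ, y ^ p ^ e ∈ Ideal.span ((fun z : Localization.AtPrime q ⧸ Ideal.span {t} => z ^ p ^ e) '' (Ideal.span (Set.range s) : Set (Localization.AtPrime q ⧸ Ideal.span {t})))) → y ∈ Ideal.span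 (Set.range s)) :=
  certificate_atPrime p x hx hreg i hxi hexc q

end Summit.ResolutionOfSingularities.ResolutionOfSingularities.Theorems.FRationalModification.MaxMultiplicityCertificateChartClause

end
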